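import Mathlib
import Literature.MathematicalPhysics.QuantumFieldTheory.Balaban1983to89.B9Eq3169Mu
import Literature.MathematicalPhysics.QuantumFieldTheory.Balaban1983to89.B6BondElimination

/-! # `Balaban1983to89.B9Eq3169Comb` — the block combs Γ_{y,x} of [5] on a union Λ of L-blocks of ℤ^d as an
# INSTANCE of the axial frame of `B9Eq3169Mu`: the tree property, |Γ_{y,x}| ≤ d(L − 1), blocks of sup-diameter L − 1,
# weights L^{−d}, axial bonds = the tree bonds of B6 — hence δ_{Ax}(B + D̄μ(B)) literally, and the locality constants of
# E = I + D̄μ(·) in (3.185) as NUMBERS: range r = L, row sums m = 1 + 4d(L − 1), *"depending on d and L only"* —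
# kernel-checked, [folklore] lattice geometry over the printed definitions

CITATION HEADER (lean-in-tree rule).  Paper sub-cell `b2b-balaban-b09` (gen 12, journal claim B9-EQ3169-COMB, cell
pub-balaban) on T. Bałaban, *Propagators for lattice gauge theories in a background field*, Commun. Math. Phys. **99**
(1985) 389–434 [`Balaban1985BackgroundPropagators`] (= B9; held `paper:balaban1985-cmp99-background-propagators`;
journal page = PDF page + 388), p. 393 [PDF 5], Sect. E pp. 427–432 [PDF 39–44], reference list p. 434 [PDF 46]; with
[5] = T. Bałaban, *Averaging operations for lattice gauge theories*, Commun. Math. Phys. **98** (1985) 17–51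
[`Balaban1985Averaging`] (journal page = PDF page + 16), p. 24 [PDF 8], p. 26 [PDF 10], p. 27 [PDF 11]; and B5 =
[`Balaban1984PropagatorsI`] (1.6)–(1.7) p. 18 THROUGH THE TREE ONLY (`B6Elimination.block`/`corner`,
`B6BondElimination.contour`/`treeBonds`, typed and cited there by the b06/pv lineage — used BY NAME, their docstrings
carry the quotations).  Renders `b2b-balaban-ref1/pages/1985-cmp99-background-propagators/…-p005-x2.png`, `…-p039-x2.png`,
`…-p040-x2.png`, `…-p042-x2.png`, `…-p044-x2.png`, `…-p046-x2.png` and `…/1985-cmp98-averaging/1985-cmp98-averaging-p008-x2.png`,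
`…-p010-x2.png`, `…-p011-x2.png` READ AS IMAGES for this module (not from an OCR layer).  USED BY NAME, nothing
restated: `B9Eq3169Mu.AxialFrame` (+ `.IsTree`, `.InAx`, `.dress`, `.dress_vanish`), `B9Eq3169Mu.IsChainFrom`, `Emat`,
`Emat_range`, `sum_abs_Emat_le`, `rep3185_of_eq3169` (gen 12: there the frame, its tree property and the three
geometric hypotheses — blocks of ρ-diameter ≤ D, bonds of ρ-length ≤ 1, axial bonds sourced in their block — and the
contour-length bound ℓ were HYPOTHESES / STRUCTURE FIELDS; here they are constructed and proved for the print's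
geometry), `B9Thm315Decay.Rep3185` / `bound_of_rep3185` (gen 11), `B4Sect5Torus.IsPseudoDist`, `B6Elimination.corner`
/ `block` / `BlockClosed` / `region` / `card_block` / `dist_le_of_corner_eq`, `B6BondElimination.unitVec` / `contour` /
`treeBonds` / `contour_add_unitVec` / `contour_subset_treeBonds`.  No existing module is modified.

WHAT IS PRINTED (verbatim).
* B9 p. 393 [PDF 5], after the one-step line of (3.18)–(3.19) *"(Q′(V)λ)(y) = Σ_{x∈B(y)} L^{−d}R(V(Γ_{y,x}))λ(x),"*:
  *"The contours Γ^{(j)}_{y,x}, x∈B^j(y), and the contour variables U(Γ^{(j)}_{y,x}) were defined by (52), (53) in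
  [5]."* — and B9's reference list p. 434 [PDF 46]: *"5. Balaban, T.: "Averaging operations for lattice gauge
  theories." Harvard preprint HUTMP B147, to be published in CMP."*  The numbers (52), (53) are the PREPRINT's: in the
  published [5] (CMP 98) (52) p. 26 [PDF 10] is the small-field condition *"|U(∂p) − 1| < α₀η², η = L^{−k}"* and (53)
  p. 26 the inductive plaquette bound *"|Ū^j(∂p) − 1| < α₀L^{2j}η² + C₀(α₀L^{2j}η²)²·[1 + L^{−2}(1 + C₀α₀)² + …
  + L^{−2(j−1)}(1 + C₀α₀)^{2(j−1)}]. (53)"* (neither defines contours; render `…-p010-x2.png` re-read as an image, v1.1),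
  and the block contours with initial point y are the UNNUMBERED display of p. 24 [PDF 8] — THE PASSAGE TYPED HERE:
  *"This means that we take the contours Γ_{y,x} = [y, (y₁, …, y_{d−1}, x_d)] ∪ … ∪ [(y₁, x₂, …, x_d), x]"* (straight
  segments in the directions d, d − 1, …, 1, read from y; = B5 (1.7) p. 18, the tree's `B6BondElimination.contour`).
  [5] p. 27 [PDF 11] writes the block axial gauge bond by bond: *"In a one-step renormalization transformation we
  consider configurations V′ satisfying axial gauge conditions in blocks:"* *"(R_{0,y}V′)(Γ_{y,x}) = Π_{b⊂Γ_{y,x}}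
  R(V₀(Γ_{y,b₋}))V′_b = 1, x ∈ B(y), x ≠ y. (58)"*.
* B9 p. 427 [PDF 39]: *"We need operators with Dirichlet boundary conditions outside some domain Λ of the unit lattice.
  We assume that Λ ⊂ Λ_k = Ω_k^{(k)}, Λ is a union of big blocks, and a distance between Λ and Λ_kᶜ is bigger than
  RM."*; (3.155): *"… g is an arbitrary Lie algebra valued function defined at bonds of Λ."*; p. 428 [PDF 40]: *"This
  form is considered on the subspace {B: B = 0 on Λᶜ, B = 0 on ⋃_{y∈Λ′}Ax(y), Q₁B = 0}."*
* B9 p. 430 [PDF 42], (3.168)–(3.169) (typed in `B9Eq3169Mu`, quoted in full there): *"… we perform the gauge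
  transformation B → B + D̄μ. This gives us the following μ-integral to calculate ∫dμ δ(Q′₁μ)δ_{Ax}(B + D̄μ)G(μ). (3.168)
  The δ-functions above determine μ uniquely as a linear function of B. Indeed, denoting V = Ū^k, we have for x∈B(y),
  y∈Λ′ …"*.
* B9 p. 432 [PDF 44]: *"C^{(k)}(Λ) = (I + D̄μ)QG̃₂Q*(I + μ*D̄*). (3.185) … The formula (3.185) implies immediately
  bounds and an exponential decay. Thus we get Theorem 3.15. For Mα₀ sufficiently small the propagator C^{(k)}(Λ) is
  given by the formula (3.185), and satisfies the bound |C^{(k)}(Λ; y, y′)| ≤ B₀e^{−δ₀|y−y′|}, y, y′ ∈ Λ (3.187) with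
  the constants B₀, δ₀ depending on d and L only."*

THE READING (typed objects; every choice is recorded in the cell's DIVERGENCE D-b09.41 — a typing, not a claim about
the print; it INSTANTIATES readings (a), (d), (f) of D-b09.40 and closes residual (ii) of GAPS C-B9-57).
(a) THE LATTICE.  The unit lattice near Λ is modelled in ℤ^d = `Fin d → ℤ` (Λ ⊂ Λ_k is a proper subdomain at distance
    > RM from Λ_kᶜ, so no torus identification is visible at the scale of one block; none is typed).  Big blocks are
    the L-cubes `B6Elimination.block L y` = B(y) of B5 (1.6) labelled by their `corner` (y ∈ LZ^d); *"Λ is a union of big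
    blocks"* = `B6Elimination.BlockClosed L Λ` (every instance `B6Elimination.region L Λ′` = ⋃_{y∈Λ′}B(y) qualifies);
    Λ′ = the corners; the base SITE of the block of x is its corner (as in D-b09.40 (a)).
(b) THE COMBS.  Γ_{y,x}, x ∈ B(y), y = corner x, is typed as the LIST `comb L x` of its unit bonds read from y (a bond
    ⟨z, z + e_μ⟩, positively oriented, is the pair (z, μ)), built by recursion: Γ_{y,y} = ∅ and Γ_{y,x} = Γ_{y,x−e_μ}
    followed by ⟨x − e_μ, x⟩, μ = μ(x) the LEAST direction in which x differs from y (the segment of direction 1 comes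
    last in the p. 24 display).  FIDELITY IS A THEOREM: the set of bonds of `comb L x` is the tree's
    `B6BondElimination.contour L y x` (B5 (1.7), typed by the b06/pv lineage) — `mem_comb_iff`, `comb_toFinset`; the
    bonds lying on some
    Γ_{y,x′}, x′ ∈ B(y) — B9's axial bonds Ax(y), p. 428 — are the tree's `B6BondElimination.treeBonds L y` (B6 p. 249)
    — `exists_mem_comb_iff`, `inAx_iff_treeBonds`.  One-step blocks only (j = 1), as (3.169) is stated for x ∈ B(y),
    y ∈ Λ′ with the one-step Q′.
(c) THE BOND CONVENTION for *"B↾_Λ"* / *"bonds of Λ"* (the print fixes none — G-adv8-1; D-b09.40 (d) left it open) is a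
    PARAMETER `BondModel L Λ`: a finite site set ⊇ Λ and a finite set of positively oriented unit bonds with endpoints
    among the sites, containing all comb bonds; sites outside Λ are SINGLETON BLOCKS with empty contour (D-b09.40 (d):
    there μ(B) = 0, `B9Eq3169Mu.AxialFrame.mu_eq_zero_of_trivial_block`).  Two instances are constructed: `both`
    (bonds with both endpoints in Λ; sites = Λ) and `star` (bonds with INITIAL point in Λ — the positively oriented
    half of the star convention ⋃_{x∈Λ}st(x) of G-adv8-1's repair; sites = Λ ∪ the outer endpoints).  Incoming
    boundary bonds (b₋ ∉ Λ, b₊ ∈ Λ) are in neither (XREAD C-A48-1 remark R3: they would make the factorisation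
    hypothesis speak at sites outside Λ); negatively oriented bonds are not separate unknowns (B(b⁻¹) is determined by
    B(b)) and are not typed.
(d) WEIGHTS AND METRIC.  The averaging weight of the frame is uniform on each block — PROVED equal to the print's L^{−d}
    on Λ (`frame_w_of_mem`, from `B6Elimination.card_block`: #B(y) = L^d) and 1 on the singleton blocks.  Distances
    are the sup-distance of ℤ^d (Mathlib's `dist` on `Fin d → ℤ`; D-b09.39's |y − y′| read as a pseudo-distance on
    sites): blocks have diameter L − 1 (`B6Elimination.dist_le_of_corner_eq`), unit bonds length 1, so D-b09.40 (f)'s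
    D = L − 1 and r = D + 1 = L; |Γ_{y,x}| = Σ_μ(x_μ − y_μ) ≤ d(L − 1) = ℓ, so m = 1 + 4ℓ = 1 + 4d(L − 1).  The chart
    σ of the sites into r1's abstract `B9.Geometry` must be a sup-isometry (hypothesis `hσ` of the edge) — the
    print's |y − y′| is not specified between Euclidean and sup norm (equivalent decay statements up to d-dependent
    constants; not typed).
(e) COVERAGE.  `Rep3185` wants every `inΛ` site to be the initial point of an index bond (`hcov`).  For `star` this is
    PROVED for `inΛ` = the chart image of Λ (`hcov_star`, d ≥ 1: x = ⟨x, x + e_μ₀⟩₋); for `both` it holds at x ∈ Λ iff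
    some forward neighbour x + e_μ lies in Λ (`exists_src_both_iff`) — it fails exactly at the upper corners of blocks
    with no forward neighbour block in Λ, so there `hcov` stays a hypothesis on `inΛ`.

WHAT THIS MODULE PROVES (kernel-checked; no `sorry`, no axiom beyond Lean's three):
1. §1–§2 comb geometry on ℤ^d (L ≥ 1): `rank` = Σ_μ(x_μ − y_μ), `dir` = μ(x), `pred` = x − e_{μ(x)} (same block, same
   corner, rank − 1); `comb` with `comb_of_eq_corner`, `comb_of_ne_corner`, `comb_induction`; `length_comb` (= rank),
   `length_comb_le` (≤ d(L − 1)); `corner_of_mem_comb` (comb bonds have both endpoints in B(y)); `comb_chain` (Γ_{y,x}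
   is a chain of unit bonds from y to x, `B9Eq3169Mu.IsChainFrom`); FIDELITY `mem_comb_iff` / `comb_toFinset` (=
   `B6BondElimination.contour L y x`) and `exists_mem_comb_iff` (⋃_{x∈B(y)}Γ_{y,x} = `treeBonds L y`); THE TREE
   PROPERTY `comb_isTree` (every bond b of Γ_{y,x} is the last bond of Γ_{y,b₊} = Γ_{y,b₋} ∪ {b}, b∓ ∈ B(y)).
2. §3 for every bond convention `M : BondModel L Λ` on a block-closed Λ: THE FRAME `M.frame hL hΛ : B9Eq3169Mu.AxialFrame
   ↥M.sites ↥M.bd` (blocks by corners on Λ, singletons off Λ; contours = combs; uniform weights) and, AS THEOREMS, every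
   hypothesis gen 12 left open: `frame_isTree` (the tree property), `length_frame_Γ_le` (ℓ = d(L − 1)), `frame_hdiam`
   (D = L − 1), `frame_hbond` (≤ 1), `frame_hin` (axial bonds sourced in their block), `isPseudoDist_dist`; fidelity
   `frame_w_of_mem` (w = L^{−d} on Λ), `frame_w_of_not_mem` (= 1 off Λ), `card_fib_of_mem` (#B(y) = L^d),
   `inAx_iff_treeBonds` (Ax(y) = `treeBonds L y`), `not_inAx_of_not_mem`; the instances `both`, `star` (and, for every
   Λ′, on `B6Elimination.region L Λ′`: `frame_region_isTree`).
3. §4 consequences: `dress_vanish_comb` — for ANY linear transports R(V(b)) on any real vector space 𝔤, E(B) = B + D̄μ(B)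
   VANISHES ON EVERY BOND OF EVERY COMB: δ_{Ax}(B + D̄μ(B)) of (3.168) literally, *"B + D̄μ = 0 on ⋃_{y∈Λ′}Ax(y)"*, now
   unconditional; in the scalar model (D-b09.40 (e)): `Emat_range_comb` (E(b, b′) ≠ 0 ⇒ |b₋ − b′₋|_∞ ≤ L — RANGE r = L)
   and `sum_abs_Emat_comb_le` (Σ_{b′}|E(b, b′)| ≤ 1 + 4d(L − 1) — ROW SUMS m); THE EDGE `rep3185_of_comb`:
   `B9Thm315Decay.Rep3185 g Bg Ck inΛ unitDist U δ₁ B₁ L (1 + 4d(L − 1))` BY NAME from a sup-isometric chart σ, GIVEN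
   `hcov` and — exactly as in gen 11/12 — the factorisation (3.185) `hfac` and the random-walk bound `hS` of S = QG̃₂Q*;
   `bound_3187_of_comb`: (3.187) at U with δ₀ = δ₁, B₀ = B₁e^{2δ₁L}(1 + 4d(L − 1))²; for the star convention with
   coverage discharged: `rep3185_star`, `bound_3187_star` (|C^{(k)}(Λ; σx, σx′)| ≤ B₀e^{−δ₁|σx − σx′|} for all x, x′ ∈ Λ,
   hypotheses: d ≥ 1 (a direction `μ₀ : Fin d`), a scalar unit `u` with `hu` : |u b| = 1 (u ≡ 1 serves), `hσ`, `hfac`,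
   `hS` — and for `bound_3187_star` also `hB₁` `hδ₁` : 0 ≤ B₁, 0 ≤ δ₁; nothing else).

WHAT IT DOES NOT PROVE (named hypotheses of printed shape, or not modelled): the factorisation (3.185) itself and the
random-walk bound of QG̃₂Q* (`hfac`, `hS`: G-B9-10 (a)(b)(c) / C-adv8-2 — OPEN, as in gen 11/12); the δ-function
bookkeeping (3.159)–(3.182) and the change of variables B → B + D̄μ with its Jacobian (C-B9-57 residual (i); by hand
C-adv4-55, C-adv8-2); the NON-ABELIAN matrix clauses (C-B9-57 residual (iii): operator blocks, the √N); the j-fold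
contours Γ^{(j)} (j ≥ 2) and the torus identifications of T_η; incoming / negatively oriented boundary bonds (reading
(c)); the Euclidean reading of |y − y′| (reading (d)); optimality of r = L, m = 1 + 4d(L − 1) (convenient bounds, as
D-b09.40 (f)).  Value = kernel certificate that the print's block geometry ([5] p. 24 = B5 (1.7), L-cubes) satisfies
every structural hypothesis of the (3.169) node and yields Theorem 3.15's locality constants as explicit functions of
d and L — typed skeleton / located gap, NOT summit progress.

CHART NOTE (v1.1; see `B9Eq3169MuN` §B, b09 gen 12, GAPS C-B9-60).  The edges `BondModel.rep3185_of_comb`,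
`bound_3187_of_comb`, `rep3185_star`, `bound_3187_star` (like `B9Eq3169Mu.rep3185_of_eq3169`, which they call) chart
the (3.185) index set into the sites THROUGH THE INITIAL POINTS, e = σ ∘ (b ↦ b₋); their hypothesis `hfac` :
C^{(k)}(Λ; σ p₋, σ q₋) = (E S Eᵀ)(p, q) therefore identifies the entries of the bond-indexed E S Eᵀ over all bond pairs
with common initial points (`B9Eq3169MuN.srcChart_forces_eq`) — harmless for d = 1 (one bond per site in either
convention here), OVER-STRONG for d ≥ 2, where d bonds leave each site while the print's C^{(k)}(Λ) is bond-indexed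
((3.155) *"defined at bonds of Λ"*).  The theorems are valid as stated (a special, non-injective chart); for
instantiation use the BOND-CHART edges `B9Eq3169MuN.comb_rep3185_of_chart` / `comb_bound_3187_of_chart` (any
χ : bonds → sites with unitDist(χ b, χ b′) = |b₋ − b′₋|_∞: ONE equation per bond pair as printed, `inΛ` := the image of
χ, no coverage hypothesis, every d ≥ 0, both conventions) or their vector-model forms `comb_rep3185Dom_N` /
`comb_bound_3187_N`; the geometry of §§1–3 and the constants r = L, m = 1 + 4d(L − 1) are unaffected.

v1.1 (DOCFIX, docstring-only; XREAD pv24-g9 **ok**, GAPS C-pv24g9-9): (D1) the header's hypothesis list of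
`rep3185_star` / `bound_3187_star` completed (`u`/`hu`, and `hB₁`/`hδ₁` for the bound); (R1) [5]'s (52)/(53) p. 26
described correctly ((52) the small-field condition, (53) the inductive plaquette bound — v1 called both "small-field
conditions"); the CHART NOTE above added (owed since `B9Eq3169MuN`).  No declaration, statement or proof changed. -/

namespace Literature.MathematicalPhysics.QuantumFieldTheory.Balaban1983to89.B9Eq3169Comb

open Finset
open scoped Matrix
open B4Sect5Torus (IsPseudoDist)
open B6Elimination (corner block mem_block corner_le lt_corner_add mem_block_corner corner_corner
  corner_eq_of_mem_block card_block BlockClosed dist_le_of_corner_eq)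
open B6BondElimination (unitVec unitVec_apply add_unitVec_apply contour mem_contour contour_self
  contour_add_unitVec treeBonds mem_treeBonds contour_subset_treeBonds add_unitVec_mem_block)
open B9Eq3169Mu

variable {d : ℕ} {L : ℕ}

/-! ## §1  Rank, the least differing direction, the predecessor -/

section Raw

/-- The number of unit bonds of Γ_{y,x}, y = the corner of the block of x: Σ_μ (x_μ − y_μ). [folklore] -/
def rank (L : ℕ) (x : Fin d → ℤ) : ℕ := ∑ i, (x i - corner L x i).toNat

/-- The directions in which x differs from its corner. [folklore] -/
def dirs (L : ℕ) (x : Fin d → ℤ) : Finset (Fin d) := Finset.univ.filter fun i => x i ≠ corner L x i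

/-- Membership in `dirs`. [folklore] -/
theorem mem_dirs {x : Fin d → ℤ} {i : Fin d} : i ∈ dirs L x ↔ x i ≠ corner L x i := by
  simp [dirs]

/-- A site other than its corner differs from it in some direction. [folklore] -/
theorem dirs_nonempty {x : Fin d → ℤ} (h : x ≠ corner L x) : (dirs L x).Nonempty := by
  by_contra hne
  rw [Finset.not_nonempty_iff_eq_empty] at hne
  apply h
  funext i
  by_contra hi
  have : i ∈ dirs L x := mem_dirs.2 hi
  rw [hne] at this
  simp at this

/-- μ(x) — the LEAST direction in which x differs from its corner: the direction of the LAST bond of Γ_{y,x}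
(the segment [(y₁, x₂, …, x_d), x] of direction 1 comes last in [5] p. 24 / B5 (1.7)).
[cite: Balaban1985Averaging, p.24; Balaban1984PropagatorsI, (1.7) p.18] -/
def dir (x : Fin d → ℤ) (h : x ≠ corner L x) : Fin d := (dirs L x).min' (dirs_nonempty h)

/-- x differs from its corner in the direction μ(x). [folklore] -/
theorem dir_spec {x : Fin d → ℤ} (h : x ≠ corner L x) : x (dir x h) ≠ corner L x (dir x h) :=
  mem_dirs.1 (Finset.min'_mem _ _)

/-- Below μ(x), x agrees with its corner. [folklore] -/
theorem eq_of_lt_dir {x : Fin d → ℤ} (h : x ≠ corner L x) {i : Fin d} (hi : i < dir x h) :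
    x i = corner L x i := by
  by_contra hne
  exact absurd hi (not_lt.2 (Finset.min'_le (dirs L x) i (mem_dirs.2 hne)))

/-- The predecessor of x on Γ_{y,x}: x − e_{μ(x)}, the initial point of the last bond. [folklore] -/
def pred (x : Fin d → ℤ) (h : x ≠ corner L x) : Fin d → ℤ := x - unitVec (dir x h)

/-- Components of the predecessor. [folklore] -/
theorem pred_apply {x : Fin d → ℤ} (h : x ≠ corner L x) (i : Fin d) :
    pred x h i = x i - if i = dir x h then 1 else 0 := by
  rw [pred, Pi.sub_apply, unitVec_apply]

/-- pred(x) + e_{μ(x)} = x. [folklore] -/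
theorem pred_add_unitVec {x : Fin d → ℤ} (h : x ≠ corner L x) : pred x h + unitVec (dir x h) = x :=
  sub_add_cancel _ _

/-- The predecessor lies in the block of x. [folklore] -/
theorem pred_mem_block (hL : 0 < L) {x : Fin d → ℤ} (h : x ≠ corner L x) :
    pred x h ∈ block L (corner L x) := by
  rw [mem_block]
  intro i
  have h1 := corner_le hL x i
  have h2 := lt_corner_add hL x i
  rw [pred_apply]
  by_cases hi : i = dir x h
  · rw [if_pos hi]
    have h3 : x i ≠ corner L x i := by rw [hi]; exact dir_spec h
    omega
  · rw [if_neg hi]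
    omega

/-- The predecessor has the same corner. [folklore] -/
theorem corner_pred (hL : 0 < L) {x : Fin d → ℤ} (h : x ≠ corner L x) : corner L (pred x h) = corner L x :=
  corner_eq_of_mem_block hL (pred_mem_block hL h)

/-- The rank vanishes exactly at the corners. [folklore] -/
theorem rank_eq_zero_iff (hL : 0 < L) {x : Fin d → ℤ} : rank L x = 0 ↔ x = corner L x := by
  constructor
  · intro h0
    funext i
    have h1 := corner_le hL x i
    have h2 : (x i - corner L x i).toNat = 0 := (Finset.sum_eq_zero_iff.1 h0) i (Finset.mem_univ i)
    omega
  · intro h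
    refine Finset.sum_eq_zero fun i _ => ?_
    have hi : x i = corner L x i := congrFun h i
    omega

/-- The rank drops by one at the predecessor. [folklore] -/
theorem rank_pred (hL : 0 < L) {x : Fin d → ℤ} (h : x ≠ corner L x) : rank L (pred x h) + 1 = rank L x := by
  unfold rank
  rw [corner_pred hL h, ← Finset.add_sum_erase _ _ (Finset.mem_univ (dir x h)),
    ← Finset.add_sum_erase _ (fun i => (x i - corner L x i).toNat) (Finset.mem_univ (dir x h))]
  have h1 : ∀ i ∈ Finset.univ.erase (dir x h), (pred x h i - corner L x i).toNat = (x i - corner L x i).toNat := by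
    intro i hi
    rw [pred_apply, if_neg (Finset.ne_of_mem_erase hi), sub_zero]
  rw [Finset.sum_congr rfl h1]
  have h2 := corner_le hL x (dir x h)
  have h3 := dir_spec h
  have h4 : pred x h (dir x h) = x (dir x h) - 1 := by rw [pred_apply, if_pos rfl]
  rw [h4]
  omega

/-- The rank is at most d(L − 1). [folklore] -/
theorem rank_le (hL : 0 < L) (x : Fin d → ℤ) : rank L x ≤ d * (L - 1) := by
  have h : ∀ i ∈ (Finset.univ : Finset (Fin d)), (x i - corner L x i).toNat ≤ L - 1 := by
    intro i _
    have h1 := corner_le hL x i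
    have h2 := lt_corner_add hL x i
    omega
  have := Finset.sum_le_card_nsmul _ _ _ h
  simpa [rank, smul_eq_mul] using this

/-! ## §2  The comb Γ_{y,x} as a list of unit bonds -/

/-- Γ_{y,x} by recursion on a fuel n ≥ rank: Γ_{y,y} = ∅, Γ_{y,x} = Γ_{y,pred x} followed by the bond
⟨pred x, x⟩ = (pred x, μ(x)). [cite: Balaban1985Averaging, p.24; Balaban1984PropagatorsI, (1.7) p.18] -/
def combAux (L : ℕ) : ℕ → (Fin d → ℤ) → List ((Fin d → ℤ) × Fin d)
  | 0, _ => []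
  | n + 1, x => if h : x = corner L x then [] else combAux L n (pred x h) ++ [(pred x h, dir x h)]

/-- THE COMB Γ_{y,x} of [5] p. 24 / B5 (1.7), y = the corner of the L-block of x, as the LIST of its unit bonds read
from y: directions d, d − 1, …, 1 in this order, each segment straight. [cite: Balaban1985Averaging, p.24;
Balaban1984PropagatorsI, (1.7) p.18] -/
def comb (L : ℕ) (x : Fin d → ℤ) : List ((Fin d → ℤ) × Fin d) := combAux L (rank L x) x

/-- Any fuel ≥ rank computes the comb. [folklore] -/
theorem combAux_eq (hL : 0 < L) : ∀ n (x : Fin d → ℤ), rank L x ≤ n → combAux L n x = comb L x := by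
  intro n
  induction n with
  | zero =>
    intro x hx
    have h0 : rank L x = 0 := by omega
    rw [comb, h0]
  | succ n ih =>
    intro x hx
    by_cases h : x = corner L x
    · have h0 : rank L x = 0 := (rank_eq_zero_iff hL).2 h
      rw [comb, h0]
      simp only [combAux, dif_pos h]
    · have hr := rank_pred hL h
      rw [comb, ← hr]
      simp only [combAux, dif_neg h]
      rw [ih (pred x h) (by omega), comb]

/-- Γ_{y,y} = ∅. [folklore] -/
theorem comb_of_eq_corner (hL : 0 < L) {x : Fin d → ℤ} (h : x = corner L x) : comb L x = [] := by
  rw [comb, (rank_eq_zero_iff hL).2 h]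
  rfl

/-- Γ_{y,x} = Γ_{y,pred x} ∪ {⟨pred x, x⟩} for x ≠ y. [folklore] -/
theorem comb_of_ne_corner (hL : 0 < L) {x : Fin d → ℤ} (h : x ≠ corner L x) :
    comb L x = comb L (pred x h) ++ [(pred x h, dir x h)] := by
  conv_lhs => rw [comb, ← rank_pred hL h]
  simp only [combAux, dif_neg h]
  rw [combAux_eq hL _ _ le_rfl]

/-- Induction along the comb. [folklore] -/
theorem comb_induction (hL : 0 < L) {P : (Fin d → ℤ) → Prop} (h0 : ∀ x, x = corner L x → P x)
    (h1 : ∀ x (h : x ≠ corner L x), P (pred x h) → P x) : ∀ x, P x := by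
  suffices H : ∀ n x, rank L x ≤ n → P x from fun x => H _ x le_rfl
  intro n
  induction n with
  | zero => intro x hx; exact h0 x ((rank_eq_zero_iff hL).1 (by omega))
  | succ n ih =>
    intro x hx
    by_cases h : x = corner L x
    · exact h0 x h
    · exact h1 x h (ih _ (by have := rank_pred hL h; omega))

/-- |Γ_{y,x}| = Σ_μ (x_μ − y_μ). [folklore] -/
theorem length_comb (hL : 0 < L) : ∀ x : Fin d → ℤ, (comb L x).length = rank L x := by
  refine comb_induction hL (fun x h => ?_) (fun x h ih => ?_)
  · rw [comb_of_eq_corner hL h, (rank_eq_zero_iff hL).2 h]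
    rfl
  · rw [comb_of_ne_corner hL h, List.length_append, ih, List.length_singleton, rank_pred hL h]

/-- |Γ_{y,x}| ≤ d(L − 1). [cite: Balaban1985BackgroundPropagators, p.432 ("constants depending on d and L only")] -/
theorem length_comb_le (hL : 0 < L) (x : Fin d → ℤ) : (comb L x).length ≤ d * (L - 1) := by
  rw [length_comb hL]
  exact rank_le hL x

/-- Every bond of Γ_{y,x} has both endpoints in the block B(y). [folklore] -/
theorem corner_of_mem_comb (hL : 0 < L) : ∀ x : Fin d → ℤ, ∀ b ∈ comb L x,
    corner L b.1 = corner L x ∧ corner L (b.1 + unitVec b.2) = corner L x := by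
  refine comb_induction hL (fun x h => ?_) (fun x h ih => ?_)
  · rw [comb_of_eq_corner hL h]
    simp
  · intro b hb
    rw [comb_of_ne_corner hL h, List.mem_append, List.mem_singleton] at hb
    rcases hb with hb | hb
    · have := ih b hb
      rwa [corner_pred hL h] at this
    · subst hb
      exact ⟨corner_pred hL h, by rw [pred_add_unitVec]⟩

/-- Appending a bond sourced at the end point extends a chain. [folklore] -/
theorem isChainFrom_append_singleton {X Bond : Type} {src tgt : Bond → X} {b : Bond} :
    ∀ {y : X} {Γ : List Bond} {z : X}, IsChainFrom src tgt y Γ z → src b = z →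
      IsChainFrom src tgt y (Γ ++ [b]) (tgt b)
  | y, [], z, h, hb => by
    rw [isChainFrom_nil] at h
    subst h
    exact ⟨hb, rfl⟩
  | y, c :: Γ, z, h, hb => by
    rw [isChainFrom_cons] at h
    exact ⟨h.1, isChainFrom_append_singleton h.2 hb⟩

/-- Γ_{y,x} is a chain of unit bonds from the corner y to x. [cite: Balaban1985Averaging, p.24] -/
theorem comb_chain (hL : 0 < L) : ∀ x : Fin d → ℤ,
    IsChainFrom Prod.fst (fun b => b.1 + unitVec b.2) (corner L x) (comb L x) x := by
  refine comb_induction hL (fun x h => ?_) (fun x h ih => ?_)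
  · rw [comb_of_eq_corner hL h, isChainFrom_nil]
    exact h.symm
  · rw [comb_of_ne_corner hL h]
    have h1 := isChainFrom_append_singleton (b := (pred x h, dir x h)) ih rfl
    rw [corner_pred hL h] at h1
    simpa [pred_add_unitVec] using h1

/-- FIDELITY with the tree's B5 (1.7) contours: the bonds of the comb list are exactly
`B6BondElimination.contour L y x`, y = corner x. [cite: Balaban1984PropagatorsI, (1.7) p.18] -/
theorem mem_comb_iff (hL : 0 < L) : ∀ x : Fin d → ℤ, ∀ b,
    b ∈ comb L x ↔ b ∈ contour L (corner L x) x := by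
  refine comb_induction hL (fun x h => ?_) (fun x h ih => ?_)
  · intro b
    rw [comb_of_eq_corner hL h, ← h, contour_self]
    simp
  · intro b
    have hz : pred x h ∈ block L (corner L x) := pred_mem_block hL h
    have h1 : ∀ i, i < dir x h → pred x h i = corner L x i := by
      intro i hi
      rw [pred_apply, if_neg (ne_of_lt hi), sub_zero]
      exact eq_of_lt_dir h hi
    have h2 := contour_add_unitVec hz h1
    rw [pred_add_unitVec] at h2
    rw [comb_of_ne_corner hL h, List.mem_append, List.mem_singleton, ih, corner_pred hL h, h2,
      Finset.mem_insert]
    tauto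

/-- The comb list as a finset IS the tree's contour. [cite: Balaban1984PropagatorsI, (1.7) p.18] -/
theorem comb_toFinset (hL : 0 < L) (x : Fin d → ℤ) : (comb L x).toFinset = contour L (corner L x) x := by
  ext b
  rw [List.mem_toFinset, mem_comb_iff hL]

/-- THE TREE PROPERTY of the combs: every bond b = ⟨x₂ − e_{μ(x₂)}, x₂⟩ of Γ_{y,x} is the last bond of Γ_{y,x₂} =
Γ_{y,b₊}, whose prefix is Γ_{y,b₋}, x₂ in the block of x. [cite: Balaban1985Averaging, p.24] -/
theorem comb_isTree (hL : 0 < L) : ∀ x : Fin d → ℤ, ∀ b ∈ comb L x,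
    ∃ x₂ : Fin d → ℤ, ∃ h₂ : x₂ ≠ corner L x₂, corner L x₂ = corner L x ∧ (pred x₂ h₂, dir x₂ h₂) = b ∧
      comb L x₂ = comb L (pred x₂ h₂) ++ [b] := by
  refine comb_induction hL (fun x h => ?_) (fun x h ih => ?_)
  · rw [comb_of_eq_corner hL h]
    simp
  · intro b hb
    rw [comb_of_ne_corner hL h, List.mem_append, List.mem_singleton] at hb
    rcases hb with hb | hb
    · obtain ⟨x₂, h₂, hc, hp, he⟩ := ih b hb
      exact ⟨x₂, h₂, hc.trans (corner_pred hL h), hp, he⟩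
    · exact ⟨x, h, rfl, hb.symm, by rw [hb, comb_of_ne_corner hL h]⟩

/-- The bonds of the combs of a block are its tree bonds (B6 p. 249): b lies on some Γ_{y,x}, x ∈ B(y), iff
b ∈ `B6BondElimination.treeBonds L y`. [cite: Balaban1984PropagatorsI, (1.7) p.18] -/
theorem exists_mem_comb_iff (hL : 0 < L) {y : Fin d → ℤ} (hy : corner L y = y) (b : (Fin d → ℤ) × Fin d) :
    (∃ x, corner L x = y ∧ b ∈ comb L x) ↔ b ∈ treeBonds L y := by
  constructor
  · rintro ⟨x, hx, hb⟩
    rw [mem_comb_iff hL, hx] at hb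
    have hxb : x ∈ block L y := by rw [← hx]; exact mem_block_corner hL x
    exact contour_subset_treeBonds hxb hb
  · intro hb
    obtain ⟨hw, h1, h3⟩ := mem_treeBonds.1 hb
    refine ⟨b.1 + unitVec b.2, ?_, ?_⟩
    · have hm := add_unitVec_mem_block hw h3
      rw [← hy] at hm
      exact (corner_eq_of_mem_block hL hm).trans hy
    · have hm := add_unitVec_mem_block hw h3
      have hc : corner L (b.1 + unitVec b.2) = y := by
        rw [← hy] at hm
        exact (corner_eq_of_mem_block hL hm).trans hy
      rw [mem_comb_iff hL, hc, contour_add_unitVec hw h1]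
      exact Finset.mem_insert_self _ _

end Raw

/-! ## §3  Bond conventions on a block-closed region Λ and the axial frame they carry -/

section Frame

variable (L) in
/-- A BOND CONVENTION for *"B↾_Λ"* (the print never fixes one — cell GAPS G-adv8-1): a finite site set containing Λ and
a finite set of positively oriented unit bonds b = ⟨z, z + e_μ⟩ ↦ (z, μ) with both endpoints among the sites, containing
every comb bond of every site of Λ.  Sites outside Λ (outer endpoints of boundary bonds) will be SINGLETON BLOCKS with
empty contour (reading (a) of `B9Eq3169Mu`: μ(B) = 0 there).  Instances: `both` (bonds with both endpoints in Λ, sites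
= Λ) and `star` (bonds with initial point in Λ, sites = Λ ∪ their endpoints).
[cite: Balaban1985BackgroundPropagators, p.427 (3.155) ("g is an arbitrary Lie algebra valued function defined at bonds
of Λ")] -/
structure BondModel (Λ : Finset (Fin d → ℤ)) where
  /-- the sites carrying μ -/
  sites : Finset (Fin d → ℤ)
  /-- the bonds carrying B, g -/
  bd : Finset ((Fin d → ℤ) × Fin d)
  subset : Λ ⊆ sites
  src_mem : ∀ b ∈ bd, b.1 ∈ sites
  tgt_mem : ∀ b ∈ bd, b.1 + unitVec b.2 ∈ sites
  comb_mem : ∀ x ∈ Λ, ∀ b ∈ comb L x, b ∈ bd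

variable {Λ : Finset (Fin d → ℤ)}

/-- The unit bonds with BOTH endpoints in Λ. [folklore] -/
def bonds (Λ : Finset (Fin d → ℤ)) : Finset ((Fin d → ℤ) × Fin d) :=
  (Λ ×ˢ (Finset.univ : Finset (Fin d))).filter fun b => b.1 + unitVec b.2 ∈ Λ

/-- Membership in `bonds`. [folklore] -/
theorem mem_bonds {b : (Fin d → ℤ) × Fin d} : b ∈ bonds Λ ↔ b.1 ∈ Λ ∧ b.1 + unitVec b.2 ∈ Λ := by
  simp [bonds]

/-- The unit bonds with INITIAL point in Λ (the positively oriented half of the star convention ⋃_{x∈Λ}st(x) of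
G-adv8-1). [folklore] -/
def bondsOut (Λ : Finset (Fin d → ℤ)) : Finset ((Fin d → ℤ) × Fin d) := Λ ×ˢ (Finset.univ : Finset (Fin d))

/-- Membership in `bondsOut`. [folklore] -/
theorem mem_bondsOut {b : (Fin d → ℤ) × Fin d} : b ∈ bondsOut Λ ↔ b.1 ∈ Λ := by
  simp [bondsOut]

/-- Λ together with the endpoints of the bonds leaving it. [folklore] -/
def sitesOut (Λ : Finset (Fin d → ℤ)) : Finset (Fin d → ℤ) := Λ ∪ (bondsOut Λ).image fun b => b.1 + unitVec b.2

/-- In a block-closed region both endpoints of a comb bond of a site of Λ lie in Λ. [folklore] -/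
theorem mem_of_mem_comb (hL : 0 < L) (hΛ : BlockClosed L Λ) {x : Fin d → ℤ} (hx : x ∈ Λ)
    {b : (Fin d → ℤ) × Fin d} (hb : b ∈ comb L x) : b.1 ∈ Λ ∧ b.1 + unitVec b.2 ∈ Λ := by
  obtain ⟨h1, h2⟩ := corner_of_mem_comb hL x b hb
  exact ⟨hΛ x hx _ h1, hΛ x hx _ h2⟩

variable (L) in
/-- THE BOTH-ENDPOINTS CONVENTION: sites = Λ, bonds = unit bonds with both endpoints in Λ.
[cite: Balaban1985BackgroundPropagators, p.427] -/
def both (hL : 0 < L) (hΛ : BlockClosed L Λ) : BondModel L Λ where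
  sites := Λ
  bd := bonds Λ
  subset := subset_rfl
  src_mem _ hb := (mem_bonds.1 hb).1
  tgt_mem _ hb := (mem_bonds.1 hb).2
  comb_mem _ hx _ hb := mem_bonds.2 (mem_of_mem_comb hL hΛ hx hb)

variable (L) in
/-- THE STAR (OUTGOING) CONVENTION: bonds = unit bonds with initial point in Λ, sites = Λ ∪ their endpoints — the
outer endpoints b₊ ∉ Λ of the bonds leaving Λ become singleton blocks (G-adv8-1: there (D̄μ)(b) = −μ(b₋)).
[cite: Balaban1985BackgroundPropagators, p.427] -/
def star (hL : 0 < L) (hΛ : BlockClosed L Λ) : BondModel L Λ where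
  sites := sitesOut Λ
  bd := bondsOut Λ
  subset := Finset.subset_union_left
  src_mem _ hb := Finset.mem_union_left _ (mem_bondsOut.1 hb)
  tgt_mem _ hb := Finset.mem_union_right _ (Finset.mem_image_of_mem _ hb)
  comb_mem _ hx _ hb := mem_bondsOut.2 (mem_of_mem_comb hL hΛ hx hb).1

namespace BondModel

variable (M : BondModel L Λ) (hL : 0 < L) (hΛ : BlockClosed L Λ)

/-- b₋. [folklore] -/
def src (b : ↥M.bd) : ↥M.sites := ⟨b.1.1, M.src_mem b.1 b.2⟩

/-- b₊. [folklore] -/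
def tgt (b : ↥M.bd) : ↥M.sites := ⟨b.1.1 + unitVec b.1.2, M.tgt_mem b.1 b.2⟩

/-- The base site of the block of a site: the corner of its L-block on Λ, itself off Λ. [folklore] -/
def blk (x : ↥M.sites) : ↥M.sites :=
  if hx : x.1 ∈ Λ then ⟨corner L x.1, M.subset (hΛ.corner_mem hL hx)⟩ else x

/-- Γ_{y,x}: the comb on Λ, empty off Λ. [cite: Balaban1985Averaging, p.24] -/
def Γ (x : ↥M.sites) : List ↥M.bd :=
  if hx : x.1 ∈ Λ then (comb L x.1).pmap (fun b hb => ⟨b, hb⟩) (M.comb_mem x.1 hx) else []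

/-- The block of a site, as a set of sites. [folklore] -/
def fib (x : ↥M.sites) : Finset ↥M.sites := Finset.univ.filter fun x' => M.blk hL hΛ x' = M.blk hL hΛ x

/-- The averaging weight: uniform on each block (= L^{−d} on Λ, `frame_w_of_mem`; 1 off Λ). [folklore] -/
noncomputable def w (x : ↥M.sites) : ℝ := ((M.fib hL hΛ x).card : ℝ)⁻¹

variable {M hL hΛ}

/-- On Λ the base site is the corner. [folklore] -/
theorem blk_of_mem {x : ↥M.sites} (hx : x.1 ∈ Λ) :
    M.blk hL hΛ x = ⟨corner L x.1, M.subset (hΛ.corner_mem hL hx)⟩ := dif_pos hx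

/-- Off Λ a site is its own block. [folklore] -/
theorem blk_of_not_mem {x : ↥M.sites} (hx : x.1 ∉ Λ) : M.blk hL hΛ x = x := dif_neg hx

/-- On Λ the base site is the corner (values). [folklore] -/
theorem blk_val_of_mem {x : ↥M.sites} (hx : x.1 ∈ Λ) : (M.blk hL hΛ x).1 = corner L x.1 := by
  rw [blk_of_mem hx]

/-- Base sites of Λ lie in Λ (block-closedness). [folklore] -/
theorem blk_val_mem {x : ↥M.sites} (hx : x.1 ∈ Λ) : (M.blk hL hΛ x).1 ∈ Λ := by
  rw [blk_val_of_mem hx]; exact hΛ.corner_mem hL hx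

/-- On Λ the contour is the comb. [folklore] -/
theorem Γ_of_mem {x : ↥M.sites} (hx : x.1 ∈ Λ) :
    M.Γ x = (comb L x.1).pmap (fun b hb => ⟨b, hb⟩) (M.comb_mem x.1 hx) := dif_pos hx

/-- Off Λ the contour is empty. [folklore] -/
theorem Γ_of_not_mem {x : ↥M.sites} (hx : x.1 ∉ Λ) : M.Γ x = [] := dif_neg hx

/-- Membership in Γ_{y,x}: only sites of Λ have nonempty contours, made of comb bonds. [folklore] -/
theorem mem_Γ_iff {x : ↥M.sites} {b : ↥M.bd} : b ∈ M.Γ x ↔ x.1 ∈ Λ ∧ b.1 ∈ comb L x.1 := by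
  by_cases hx : x.1 ∈ Λ
  · rw [Γ_of_mem hx, List.mem_pmap]
    constructor
    · rintro ⟨a, ha, hab⟩
      rw [← hab]
      exact ⟨hx, ha⟩
    · intro hb
      exact ⟨b.1, hb.2, rfl⟩
  · rw [Γ_of_not_mem hx]
    simp [hx]

/-- Same block ⇒ both in Λ with the same corner, or equal off Λ. [folklore] -/
theorem blk_eq_iff {x x' : ↥M.sites} : M.blk hL hΛ x' = M.blk hL hΛ x ↔
    (x.1 ∈ Λ ∧ x'.1 ∈ Λ ∧ corner L x'.1 = corner L x.1) ∨ (x.1 ∉ Λ ∧ x' = x) := by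
  by_cases hx : x.1 ∈ Λ
  · by_cases hx' : x'.1 ∈ Λ
    · rw [blk_of_mem hx, blk_of_mem hx']
      constructor
      · intro h; exact Or.inl ⟨hx, hx', congrArg Subtype.val h⟩
      · rintro (⟨-, -, h⟩ | ⟨h, -⟩)
        · exact Subtype.ext h
        · exact absurd hx h
    · rw [blk_of_mem hx, blk_of_not_mem hx']
      constructor
      · intro h
        have : x'.1 = corner L x.1 := congrArg Subtype.val h
        exact absurd (this ▸ hΛ.corner_mem hL hx) hx'
      · rintro (⟨-, h, -⟩ | ⟨h, -⟩)
        · exact absurd h hx'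
        · exact absurd hx h
  · constructor
    · intro h
      by_cases hx' : x'.1 ∈ Λ
      · rw [blk_of_mem hx', blk_of_not_mem hx] at h
        have : corner L x'.1 = x.1 := congrArg Subtype.val h
        exact absurd (this ▸ hΛ.corner_mem hL hx') hx
      · rw [blk_of_not_mem hx', blk_of_not_mem hx] at h
        exact Or.inr ⟨hx, h⟩
    · rintro (⟨h, -, -⟩ | ⟨-, h⟩)
      · exact absurd h hx
      · rw [h]

/-- Chain transfer from raw sites to the model's sites. [folklore] -/
theorem isChainFrom_pmap :
    ∀ (l : List ((Fin d → ℤ) × Fin d)) (H : ∀ b ∈ l, b ∈ M.bd) (y z : ↥M.sites),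
      IsChainFrom Prod.fst (fun b => b.1 + unitVec b.2) y.1 l z.1 →
        IsChainFrom M.src M.tgt y (l.pmap (fun b hb => (⟨b, hb⟩ : ↥M.bd)) H) z
  | [], H, y, z, h => by
    rw [isChainFrom_nil] at h
    rw [List.pmap, isChainFrom_nil]
    exact Subtype.ext h
  | b :: l, H, y, z, h => by
    rw [isChainFrom_cons] at h
    rw [List.pmap, isChainFrom_cons]
    refine ⟨Subtype.ext h.1, ?_⟩
    exact isChainFrom_pmap l _ (M.tgt ⟨b, H b (by simp)⟩) z h.2

/-- pmap along equal lists. [folklore] -/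
theorem pmap_congr_of_eq {α β : Type} {p : α → Prop} (f : ∀ a, p a → β) {l l' : List α} (h : l = l')
    (H : ∀ a ∈ l, p a) (H' : ∀ a ∈ l', p a) : l.pmap f H = l'.pmap f H' := by
  subst h
  rfl

/-- x lies in its own block. [folklore] -/
theorem mem_fib_self (x : ↥M.sites) : x ∈ M.fib hL hΛ x := by
  simp [fib]

/-- Sites of one block have the same block. [folklore] -/
theorem fib_eq {x x' : ↥M.sites} (h : M.blk hL hΛ x' = M.blk hL hΛ x) : M.fib hL hΛ x' = M.fib hL hΛ x := by
  ext z
  simp [fib, h]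

variable (M hL hΛ)

/-- THE AXIAL FRAME carried by a bond convention on Λ: blocks by corners on Λ (singletons off Λ), the combs Γ_{y,x},
uniform block weights. [cite: Balaban1985BackgroundPropagators, p.427 + p.430 (3.169); Balaban1985Averaging, p.24] -/
noncomputable def frame : AxialFrame ↥M.sites ↥M.bd where
  src := M.src
  tgt := M.tgt
  blk := M.blk hL hΛ
  Γ := M.Γ
  w := M.w hL hΛ
  blk_blk x := by
    by_cases hx : x.1 ∈ Λ
    · have hc : (M.blk hL hΛ x).1 ∈ Λ := blk_val_mem hx
      rw [blk_of_mem hc]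
      apply Subtype.ext
      show corner L (M.blk hL hΛ x).1 = (M.blk hL hΛ x).1
      rw [blk_val_of_mem hx, corner_corner hL]
    · rw [blk_of_not_mem hx, blk_of_not_mem hx]
  chain x := by
    by_cases hx : x.1 ∈ Λ
    · rw [Γ_of_mem hx, blk_of_mem hx]
      exact isChainFrom_pmap _ _ ⟨corner L x.1, _⟩ x (comb_chain hL x.1)
    · rw [Γ_of_not_mem hx, blk_of_not_mem hx, isChainFrom_nil]
  Γ_blk x := by
    by_cases hx : x.1 ∈ Λ
    · have hc : (M.blk hL hΛ x).1 ∈ Λ := blk_val_mem hx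
      have h0 : comb L (M.blk hL hΛ x).1 = [] := by
        rw [blk_val_of_mem hx]
        exact comb_of_eq_corner hL (corner_corner hL x.1).symm
      rw [Γ_of_mem hc, pmap_congr_of_eq _ h0 _ (by simp)]
      rfl
    · rw [blk_of_not_mem hx, Γ_of_not_mem hx]
  w_nonneg x := inv_nonneg.2 (Nat.cast_nonneg _)
  w_sum x := by
    have h1 : ∀ x' ∈ Finset.univ.filter (fun x' => M.blk hL hΛ x' = M.blk hL hΛ x),
        M.w hL hΛ x' = M.w hL hΛ x := by
      intro x' hx'
      show ((M.fib hL hΛ x').card : ℝ)⁻¹ = ((M.fib hL hΛ x).card : ℝ)⁻¹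
      rw [fib_eq (Finset.mem_filter.1 hx').2]
    rw [Finset.sum_congr rfl h1, Finset.sum_const, nsmul_eq_mul]
    have h2 : (M.fib hL hΛ x).card ≠ 0 := Finset.card_ne_zero_of_mem (mem_fib_self x)
    have h3 : ((M.fib hL hΛ x).card : ℝ) ≠ 0 := by exact_mod_cast h2
    exact mul_inv_cancel₀ h3

/-! ### The frame's data, unfolded -/

/-- Unfolding: b₋. [folklore] -/
@[simp] theorem frame_src_val (b : ↥M.bd) : ((M.frame hL hΛ).src b).1 = b.1.1 := rfl

/-- Unfolding: b₊. [folklore] -/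
@[simp] theorem frame_tgt_val (b : ↥M.bd) : ((M.frame hL hΛ).tgt b).1 = b.1.1 + unitVec b.1.2 := rfl

/-- Unfolding: blocks. [folklore] -/
theorem frame_blk (x : ↥M.sites) : (M.frame hL hΛ).blk x = M.blk hL hΛ x := rfl

/-- Unfolding: contours. [folklore] -/
theorem frame_Γ (x : ↥M.sites) : (M.frame hL hΛ).Γ x = M.Γ x := rfl

/-- Unfolding: weights. [folklore] -/
theorem frame_w (x : ↥M.sites) : (M.frame hL hΛ).w x = ((M.fib hL hΛ x).card : ℝ)⁻¹ := rfl

/-- Membership in the frame's contours. [folklore] -/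
theorem mem_frame_Γ {x : ↥M.sites} {b : ↥M.bd} : b ∈ (M.frame hL hΛ).Γ x ↔ x.1 ∈ Λ ∧ b.1 ∈ comb L x.1 :=
  mem_Γ_iff

/-! ### The geometric hypotheses of `B9Eq3169Mu`, as theorems -/

/-- |Γ_{y,x}| ≤ d(L − 1). [cite: Balaban1985BackgroundPropagators, p.432 ("depending on d and L only")] -/
theorem length_frame_Γ_le (x : ↥M.sites) : (((M.frame hL hΛ).Γ x).length : ℝ) ≤ d * ((L : ℝ) - 1) := by
  have hL1 : (1 : ℝ) ≤ L := by exact_mod_cast hL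
  have h3 : ((d * (L - 1) : ℕ) : ℝ) = d * ((L : ℝ) - 1) := by
    rw [Nat.cast_mul, Nat.cast_sub (by omega : 1 ≤ L), Nat.cast_one]
  have h0 : (0 : ℝ) ≤ d * ((L : ℝ) - 1) := mul_nonneg (Nat.cast_nonneg _) (by linarith)
  rw [frame_Γ]
  by_cases hx : x.1 ∈ Λ
  · rw [Γ_of_mem hx, List.length_pmap]
    have h2 : ((comb L x.1).length : ℝ) ≤ ((d * (L - 1) : ℕ) : ℝ) := by exact_mod_cast length_comb_le hL x.1
    linarith
  · rw [Γ_of_not_mem hx]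
    simpa using h0

/-- THE TREE PROPERTY holds: every bond of Γ_{y,x} is the last bond of Γ_{y,b₊}, with prefix Γ_{y,b₋}.
[cite: Balaban1985Averaging, p.24] -/
theorem frame_isTree : (M.frame hL hΛ).IsTree := by
  intro x b hb
  obtain ⟨hx, hb⟩ := (M.mem_frame_Γ hL hΛ).1 hb
  obtain ⟨x₂, h₂, hc, -, he⟩ := comb_isTree hL x.1 b.1 hb
  have hx₂ : x₂ ∈ Λ := hΛ x.1 hx x₂ hc
  have hx₁ : pred x₂ h₂ ∈ Λ := hΛ x.1 hx _ ((corner_pred hL h₂).trans hc)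
  refine ⟨⟨pred x₂ h₂, M.subset hx₁⟩, ⟨x₂, M.subset hx₂⟩, ?_⟩
  rw [frame_Γ, frame_Γ, Γ_of_mem (show (⟨x₂, M.subset hx₂⟩ : ↥M.sites).1 ∈ Λ from hx₂),
    Γ_of_mem (show (⟨pred x₂ h₂, M.subset hx₁⟩ : ↥M.sites).1 ∈ Λ from hx₁),
    pmap_congr_of_eq _ he _ (fun a ha => ?_), List.pmap_append]
  · rfl
  · rw [List.mem_append, List.mem_singleton] at ha
    rcases ha with ha | ha
    · exact M.comb_mem _ hx₁ a ha
    · rw [ha]; exact b.2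

/-- Axial bonds are sourced in their block. [folklore] -/
theorem frame_hin (x : ↥M.sites) (b' : ↥M.bd) (hb' : b' ∈ (M.frame hL hΛ).Γ x) :
    (M.frame hL hΛ).blk ((M.frame hL hΛ).src b') = (M.frame hL hΛ).blk x := by
  obtain ⟨hx, hb⟩ := (M.mem_frame_Γ hL hΛ).1 hb'
  have h1 := (corner_of_mem_comb hL x.1 b'.1 hb).1
  have hs : ((M.frame hL hΛ).src b').1 ∈ Λ := (mem_of_mem_comb hL hΛ hx hb).1
  rw [frame_blk, frame_blk, blk_of_mem hs, blk_of_mem hx]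
  exact Subtype.ext h1

/-- The sup-distance of ℤ^d restricted to the sites is a pseudo-distance. [folklore] -/
theorem isPseudoDist_dist : IsPseudoDist fun x x' : ↥M.sites => dist x.1 x'.1 where
  symm _ _ := dist_comm _ _
  zero _ := dist_self _
  triangle _ _ _ := dist_triangle _ _ _

/-- Blocks have sup-diameter ≤ L − 1 (singleton blocks: 0). [cite: Balaban1984PropagatorsI, (1.6) p.18] -/
theorem frame_hdiam (x x' : ↥M.sites) (h : (M.frame hL hΛ).blk x' = (M.frame hL hΛ).blk x) :
    dist x.1 x'.1 ≤ (L : ℝ) - 1 := by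
  rw [frame_blk, frame_blk, blk_eq_iff] at h
  rcases h with ⟨-, -, h⟩ | ⟨-, h⟩
  · exact dist_le_of_corner_eq hL h.symm
  · rw [h, dist_self]
    have hL1 : (1 : ℝ) ≤ L := by exact_mod_cast hL
    linarith

/-- Unit bonds have sup-length ≤ 1. [folklore] -/
theorem dist_add_unitVec_le (z : Fin d → ℤ) (μ : Fin d) : dist z (z + unitVec μ) ≤ 1 := by
  refine (dist_pi_le_iff zero_le_one).2 fun i => ?_
  rw [add_unitVec_apply, Int.dist_eq]
  by_cases hi : i = μ
  · rw [if_pos hi]; push_cast; norm_num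
  · rw [if_neg hi]; push_cast; norm_num

/-- The frame's bonds have sup-length ≤ 1. [folklore] -/
theorem frame_hbond (b : ↥M.bd) : dist ((M.frame hL hΛ).src b).1 ((M.frame hL hΛ).tgt b).1 ≤ 1 :=
  dist_add_unitVec_le _ _

/-! ### Fidelity: weights L^{−d}, axial bonds = tree bonds -/

/-- On Λ every block has L^d sites. [cite: Balaban1984PropagatorsI, (1.6) p.18] -/
theorem card_fib_of_mem {x : ↥M.sites} (hx : x.1 ∈ Λ) : (M.fib hL hΛ x).card = L ^ d := by
  rw [← card_block (L := L) (corner L x.1)]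
  refine Finset.card_bij (fun z _ => z.1) (fun z hz => ?_) (fun z₁ _ z₂ _ h => Subtype.ext h) (fun z hz => ?_)
  · have h := (Finset.mem_filter.1 hz).2
    rw [blk_eq_iff] at h
    rcases h with ⟨-, -, h⟩ | ⟨h, -⟩
    · rw [← h]; exact mem_block_corner hL z.1
    · exact absurd hx h
  · have hc : corner L z = corner L x.1 := corner_eq_of_mem_block hL hz
    have hz' : z ∈ Λ := hΛ x.1 hx z hc
    exact ⟨⟨z, M.subset hz'⟩, Finset.mem_filter.2 ⟨Finset.mem_univ _, blk_eq_iff.2 (Or.inl ⟨hx, hz', hc⟩)⟩, rfl⟩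

/-- Off Λ the blocks are singletons. [folklore] -/
theorem fib_of_not_mem {x : ↥M.sites} (hx : x.1 ∉ Λ) : M.fib hL hΛ x = {x} := by
  ext z
  rw [fib, Finset.mem_filter, Finset.mem_singleton, blk_eq_iff]
  constructor
  · rintro ⟨-, ⟨h, -, -⟩ | ⟨-, h⟩⟩
    · exact absurd h hx
    · exact h
  · intro h
    exact ⟨Finset.mem_univ _, Or.inr ⟨hx, h⟩⟩

/-- WEIGHT FIDELITY on Λ: w = L^{−d}, the print's weight in (Q′·)(y) = Σ_{x∈B(y)} L^{−d}(·)(x).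
[cite: Balaban1985BackgroundPropagators, p.393 (3.18)–(3.19)] -/
theorem frame_w_of_mem {x : ↥M.sites} (hx : x.1 ∈ Λ) : (M.frame hL hΛ).w x = ((L : ℝ) ^ d)⁻¹ := by
  rw [frame_w, card_fib_of_mem M hL hΛ hx, Nat.cast_pow]

/-- Off Λ: w = 1 (singleton blocks). [folklore] -/
theorem frame_w_of_not_mem {x : ↥M.sites} (hx : x.1 ∉ Λ) : (M.frame hL hΛ).w x = 1 := by
  rw [frame_w, fib_of_not_mem M hL hΛ hx, Finset.card_singleton, Nat.cast_one, inv_one]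

/-- AXIAL-BOND FIDELITY: for x ∈ Λ the axial bonds Ax(y) of its block — the bonds lying on some Γ_{y,x′}, x′ ∈ B(y)
— are exactly the tree bonds `B6BondElimination.treeBonds L y` (B6 p. 249 / B5 (1.7)).
[cite: Balaban1985BackgroundPropagators, p.428; Balaban1984PropagatorsI, (1.7) p.18] -/
theorem inAx_iff_treeBonds {x : ↥M.sites} (hx : x.1 ∈ Λ) (b : ↥M.bd) :
    (M.frame hL hΛ).InAx x b ↔ b.1 ∈ treeBonds L (corner L x.1) := by
  rw [← exists_mem_comb_iff hL (corner_corner hL x.1) b.1]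
  constructor
  · rintro ⟨x', hx', hb⟩
    obtain ⟨hx'Λ, hb⟩ := (M.mem_frame_Γ hL hΛ).1 hb
    rw [frame_blk, frame_blk, blk_eq_iff] at hx'
    rcases hx' with ⟨-, -, h⟩ | ⟨h, -⟩
    · exact ⟨x'.1, h, hb⟩
    · exact absurd hx h
  · rintro ⟨x₀, hx₀, hb⟩
    have hx₀Λ : x₀ ∈ Λ := hΛ x.1 hx x₀ hx₀
    refine ⟨⟨x₀, M.subset hx₀Λ⟩, ?_, (M.mem_frame_Γ hL hΛ).2 ⟨hx₀Λ, hb⟩⟩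
    rw [frame_blk, frame_blk, blk_eq_iff]
    exact Or.inl ⟨hx, hx₀Λ, hx₀⟩

/-- Off Λ there are no axial bonds. [folklore] -/
theorem not_inAx_of_not_mem {x : ↥M.sites} (hx : x.1 ∉ Λ) (b : ↥M.bd) : ¬ (M.frame hL hΛ).InAx x b := by
  rintro ⟨x', hx', hb⟩
  obtain ⟨hx'Λ, -⟩ := (M.mem_frame_Γ hL hΛ).1 hb
  rw [frame_blk, frame_blk, blk_eq_iff] at hx'
  rcases hx' with ⟨h, -, -⟩ | ⟨-, h⟩
  · exact hx h
  · exact hx (h ▸ hx'Λ)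

/-! ## §4  Consequences: literal axial gauge, range ≤ L, row sums ≤ 1 + 4d(L − 1), the edge into `Rep3185` -/

/-- δ_{Ax} LITERALLY: for ANY linear transports R(V(b)), E(B) = B + D̄μ(B) vanishes on every bond of every comb
(`B9Eq3169Mu.AxialFrame.dress_vanish`, its tree hypothesis now a theorem).
[cite: Balaban1985BackgroundPropagators, (3.168) p.430 + p.428] -/
theorem dress_vanish_comb {𝔤 : Type} [AddCommGroup 𝔤] [Module ℝ 𝔤] (R : ↥M.bd → 𝔤 ≃ₗ[ℝ] 𝔤) (B : ↥M.bd → 𝔤) :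
    ∀ x, ∀ b ∈ (M.frame hL hΛ).Γ x, (M.frame hL hΛ).dress R B b = 0 :=
  (M.frame hL hΛ).dress_vanish R (M.frame_isTree hL hΛ) B

/-- RANGE ≤ L: in the scalar model the matrix of E = I + D̄μ(·) couples only bonds whose initial points are at
sup-distance ≤ L. [cite: Balaban1985BackgroundPropagators, p.432 ("depending on d and L only")] -/
theorem Emat_range_comb (u : ↥M.bd → ℝ) (b b' : ↥M.bd) (h : Emat (M.frame hL hΛ) u b b' ≠ 0) :
    dist b.1.1 b'.1.1 ≤ L := by
  have h1 := Emat_range (M.frame hL hΛ) u (fun x x' : ↥M.sites => dist x.1 x'.1) (M.isPseudoDist_dist)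
    (M.frame_hdiam hL hΛ) (M.frame_hbond hL hΛ) (M.frame_hin hL hΛ) b b' h
  have h2 : ((L : ℝ) - 1) + 1 = L := by ring
  rw [h2] at h1
  exact h1

/-- ROW SUMS ≤ 1 + 4d(L − 1) in the scalar model with |u| = 1.
[cite: Balaban1985BackgroundPropagators, p.432 ("depending on d and L only")] -/
theorem sum_abs_Emat_comb_le (u : ↥M.bd → ℝ) (hu : ∀ b, |u b| = 1) (b : ↥M.bd) :
    ∑ b', |Emat (M.frame hL hΛ) u b b'| ≤ 1 + 4 * (d * ((L : ℝ) - 1)) :=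
  sum_abs_Emat_le (M.frame hL hΛ) u hu (M.length_frame_Γ_le hL hΛ) b

/-- THE EDGE for Λ ⊂ ℤ^d a union of L-blocks: the (3.185) data `Rep3185 … U δ₁ B₁ L (1 + 4d(L − 1))` — range and
row-sum constants DEPENDING ON d AND L ONLY — from a chart σ of the sites into the `B9.Geometry` that is an isometry
for the sup-distance, GIVEN (hypotheses, as in gen 11/12: G-B9-10 OPEN) that the `inΛ` sites are initial points of
bonds under σ (`hcov`; discharged for the star convention in `hcov_star`), the factorisation (3.185) of C^{(k)}(Λ)
through E = I + D̄μ(·) and S = QG̃₂Q*, and the random-walk bound on S.  CHART NOTE (v1.1): the chart is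
e = σ ∘ (b ↦ b₋), so `hfac` identifies (E S Eᵀ)(p, q) over bond pairs with common initial points (over-strong for
d ≥ 2, `B9Eq3169MuN.srcChart_forces_eq`); the bond-chart form is `B9Eq3169MuN.comb_rep3185_of_chart`.
[cite: Balaban1985BackgroundPropagators, (3.185) + (3.187) p.432] -/
theorem rep3185_of_comb {g : B9.Geometry} {Bg : B9.Backgrounds} {Ck : B9.SiteKernel g Bg} {inΛ : g.Site → Prop}
    {unitDist : g.Site → g.Site → ℝ} {U : Bg.Cfg} {δ₁ B₁ : ℝ}
    (u : ↥M.bd → ℝ) (hu : ∀ b, |u b| = 1) (σ : ↥M.sites → g.Site)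
    (hσ : ∀ x x', unitDist (σ x) (σ x') = dist x.1 x'.1)
    (hcov : ∀ y, inΛ y → ∃ b : ↥M.bd, σ ((M.frame hL hΛ).src b) = y)
    (S : Matrix ↥M.bd ↥M.bd ℝ)
    (hfac : ∀ p q, Ck.ker U (σ ((M.frame hL hΛ).src p)) (σ ((M.frame hL hΛ).src q)) =
      (Emat (M.frame hL hΛ) u * S * (Emat (M.frame hL hΛ) u)ᵀ) p q)
    (hS : ∀ p q, |S p q| ≤
      B₁ * Real.exp (-(δ₁ * unitDist (σ ((M.frame hL hΛ).src p)) (σ ((M.frame hL hΛ).src q))))) :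
    B9Thm315Decay.Rep3185 g Bg Ck inΛ unitDist U δ₁ B₁ L (1 + 4 * (d * ((L : ℝ) - 1))) := by
  have hρ : IsPseudoDist fun x x' : ↥M.sites => unitDist (σ x) (σ x') := by
    have h : (fun x x' : ↥M.sites => unitDist (σ x) (σ x')) = fun x x' : ↥M.sites => dist x.1 x'.1 := by
      funext x x'; exact hσ x x'
    rw [h]; exact M.isPseudoDist_dist
  have hdiam : ∀ x x', (M.frame hL hΛ).blk x' = (M.frame hL hΛ).blk x →
      unitDist (σ x) (σ x') ≤ (L : ℝ) - 1 := by
    intro x x' h; rw [hσ]; exact M.frame_hdiam hL hΛ x x' h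
  have hbond : ∀ b, unitDist (σ ((M.frame hL hΛ).src b)) (σ ((M.frame hL hΛ).tgt b)) ≤ 1 := by
    intro b; rw [hσ]; exact M.frame_hbond hL hΛ b
  have h := rep3185_of_eq3169 (M.frame hL hΛ) u hu (M.length_frame_Γ_le hL hΛ) σ hρ hdiam hbond
    (M.frame_hin hL hΛ) hcov S hfac hS
  have h2 : ((L : ℝ) - 1) + 1 = L := by ring
  rw [h2] at h
  exact h

/-- Hence (3.187) at U with δ₀ = δ₁ and B₀ = B₁e^{2δ₁L}(1 + 4d(L − 1))² — *"B₀, δ₀ depending on d and L only"* up to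
the two inputs B₁, δ₁ of the random-walk bound. [cite: Balaban1985BackgroundPropagators, (3.187) p.432] -/
theorem bound_3187_of_comb {g : B9.Geometry} {Bg : B9.Backgrounds} {Ck : B9.SiteKernel g Bg} {inΛ : g.Site → Prop}
    {unitDist : g.Site → g.Site → ℝ} {U : Bg.Cfg} {δ₁ B₁ : ℝ} (hB₁ : 0 ≤ B₁) (hδ₁ : 0 ≤ δ₁)
    (u : ↥M.bd → ℝ) (hu : ∀ b, |u b| = 1) (σ : ↥M.sites → g.Site)
    (hσ : ∀ x x', unitDist (σ x) (σ x') = dist x.1 x'.1)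
    (hcov : ∀ y, inΛ y → ∃ b : ↥M.bd, σ ((M.frame hL hΛ).src b) = y)
    (S : Matrix ↥M.bd ↥M.bd ℝ)
    (hfac : ∀ p q, Ck.ker U (σ ((M.frame hL hΛ).src p)) (σ ((M.frame hL hΛ).src q)) =
      (Emat (M.frame hL hΛ) u * S * (Emat (M.frame hL hΛ) u)ᵀ) p q)
    (hS : ∀ p q, |S p q| ≤
      B₁ * Real.exp (-(δ₁ * unitDist (σ ((M.frame hL hΛ).src p)) (σ ((M.frame hL hΛ).src q))))) :
    ∀ y y', inΛ y → inΛ y' →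
      |Ck.ker U y y'| ≤ B₁ * Real.exp (2 * δ₁ * L) * (1 + 4 * (d * ((L : ℝ) - 1))) * (1 + 4 * (d * ((L : ℝ) - 1))) *
        Real.exp (-(δ₁ * unitDist y y')) :=
  B9Thm315Decay.bound_of_rep3185 hB₁ hδ₁ (M.rep3185_of_comb hL hΛ u hu σ hσ hcov S hfac hS)

end BondModel

/-! ### The two conventions: coverage -/

/-- STAR CONVENTION: every site of Λ is the initial point of a bond (d ≥ 1), so `hcov` holds for `inΛ` = the image of
Λ under the chart. [folklore] -/
theorem hcov_star (hL : 0 < L) (hΛ : BlockClosed L Λ) (μ₀ : Fin d) {Site : Type} (σ : ↥(star L hL hΛ).sites → Site)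
    (y : Site) (hy : ∃ x : ↥(star L hL hΛ).sites, x.1 ∈ Λ ∧ σ x = y) :
    ∃ b : ↥(star L hL hΛ).bd, σ (((star L hL hΛ).frame hL hΛ).src b) = y := by
  obtain ⟨x, hx, hxy⟩ := hy
  refine ⟨⟨(x.1, μ₀), mem_bondsOut.2 hx⟩, ?_⟩
  rw [← hxy]
  rfl

/-- STAR CONVENTION, COVERAGE DISCHARGED (d ≥ 1): the (3.185) data for `inΛ` = the chart image of Λ, with ONLY
the chart isometry, the factorisation (3.185) and the random-walk bound of S = QG̃₂Q* as hypotheses (G-B9-10 OPEN)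
— plus the scalar unit `u` (`hu`).  CHART NOTE (v1.1): as for `BondModel.rep3185_of_comb`, the b₋-chart makes `hfac`
over-strong for d ≥ 2; the bond-chart form `B9Eq3169MuN.comb_rep3185_of_chart` needs neither `hcov_star` nor d ≥ 1.
[cite: Balaban1985BackgroundPropagators, (3.185) + (3.187) p.432] -/
theorem rep3185_star (hL : 0 < L) (hΛ : BlockClosed L Λ) (μ₀ : Fin d) {g : B9.Geometry} {Bg : B9.Backgrounds}
    {Ck : B9.SiteKernel g Bg} {unitDist : g.Site → g.Site → ℝ} {U : Bg.Cfg} {δ₁ B₁ : ℝ}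
    (u : ↥(star L hL hΛ).bd → ℝ) (hu : ∀ b, |u b| = 1) (σ : ↥(star L hL hΛ).sites → g.Site)
    (hσ : ∀ x x', unitDist (σ x) (σ x') = dist x.1 x'.1)
    (S : Matrix ↥(star L hL hΛ).bd ↥(star L hL hΛ).bd ℝ)
    (hfac : ∀ p q, Ck.ker U (σ (((star L hL hΛ).frame hL hΛ).src p)) (σ (((star L hL hΛ).frame hL hΛ).src q)) =
      (Emat ((star L hL hΛ).frame hL hΛ) u * S * (Emat ((star L hL hΛ).frame hL hΛ) u)ᵀ) p q)
    (hS : ∀ p q, |S p q| ≤ B₁ * Real.exp (-(δ₁ *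
      unitDist (σ (((star L hL hΛ).frame hL hΛ).src p)) (σ (((star L hL hΛ).frame hL hΛ).src q))))) :
    B9Thm315Decay.Rep3185 g Bg Ck (fun y => ∃ x : ↥(star L hL hΛ).sites, x.1 ∈ Λ ∧ σ x = y) unitDist U δ₁ B₁ L
      (1 + 4 * (d * ((L : ℝ) - 1))) :=
  (star L hL hΛ).rep3185_of_comb hL hΛ u hu σ hσ (fun y hy => hcov_star hL hΛ μ₀ σ y hy) S hfac hS

/-- … hence (3.187) on Λ × Λ for the star convention, B₀ = B₁e^{2δ₁L}(1 + 4d(L − 1))², δ₀ = δ₁.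
[cite: Balaban1985BackgroundPropagators, (3.187) p.432] -/
theorem bound_3187_star (hL : 0 < L) (hΛ : BlockClosed L Λ) (μ₀ : Fin d) {g : B9.Geometry} {Bg : B9.Backgrounds}
    {Ck : B9.SiteKernel g Bg} {unitDist : g.Site → g.Site → ℝ} {U : Bg.Cfg} {δ₁ B₁ : ℝ} (hB₁ : 0 ≤ B₁)
    (hδ₁ : 0 ≤ δ₁) (u : ↥(star L hL hΛ).bd → ℝ) (hu : ∀ b, |u b| = 1) (σ : ↥(star L hL hΛ).sites → g.Site)
    (hσ : ∀ x x', unitDist (σ x) (σ x') = dist x.1 x'.1)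
    (S : Matrix ↥(star L hL hΛ).bd ↥(star L hL hΛ).bd ℝ)
    (hfac : ∀ p q, Ck.ker U (σ (((star L hL hΛ).frame hL hΛ).src p)) (σ (((star L hL hΛ).frame hL hΛ).src q)) =
      (Emat ((star L hL hΛ).frame hL hΛ) u * S * (Emat ((star L hL hΛ).frame hL hΛ) u)ᵀ) p q)
    (hS : ∀ p q, |S p q| ≤ B₁ * Real.exp (-(δ₁ *
      unitDist (σ (((star L hL hΛ).frame hL hΛ).src p)) (σ (((star L hL hΛ).frame hL hΛ).src q)))))
    (x x' : ↥(star L hL hΛ).sites) (hx : x.1 ∈ Λ) (hx' : x'.1 ∈ Λ) :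
    |Ck.ker U (σ x) (σ x')| ≤ B₁ * Real.exp (2 * δ₁ * L) * (1 + 4 * (d * ((L : ℝ) - 1))) *
      (1 + 4 * (d * ((L : ℝ) - 1))) * Real.exp (-(δ₁ * unitDist (σ x) (σ x'))) :=
  B9Thm315Decay.bound_of_rep3185 hB₁ hδ₁ (rep3185_star hL hΛ μ₀ u hu σ hσ S hfac hS) (σ x) (σ x') ⟨x, hx, rfl⟩
    ⟨x', hx', rfl⟩

/-- BOTH-ENDPOINTS CONVENTION: a site of Λ is the initial point of a bond iff one of its forward neighbours lies in
Λ — the sites NOT covered are the upper corners x = y + (L − 1, …, L − 1) of blocks B(y) none of whose forward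
neighbour blocks meets Λ; there `hcov` is a genuine hypothesis on `inΛ`. [folklore] -/
theorem exists_src_both_iff (hL : 0 < L) (hΛ : BlockClosed L Λ) (x : ↥(both L hL hΛ).sites) :
    (∃ b : ↥(both L hL hΛ).bd, ((both L hL hΛ).frame hL hΛ).src b = x) ↔ ∃ μ : Fin d, x.1 + unitVec μ ∈ Λ := by
  constructor
  · rintro ⟨b, hb⟩
    refine ⟨b.1.2, ?_⟩
    have h1 : b.1.1 = x.1 := congrArg Subtype.val hb
    rw [← h1]
    exact (mem_bonds.1 b.2).2
  · rintro ⟨μ, hμ⟩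
    exact ⟨⟨(x.1, μ), mem_bonds.2 ⟨x.2, hμ⟩⟩, rfl⟩

/-- INSTANCES EXIST FOR EVERY Λ′: both frames of the region ⋃_{y∈Λ′} B(y) (`B6Elimination.region`), *"Λ is a union
of big blocks"*, have the tree property. [cite: Balaban1985BackgroundPropagators, p.427] -/
theorem frame_region_isTree (hL : 0 < L) (Λ' : Finset (Fin d → ℤ)) :
    ((both L hL (B6Elimination.blockClosed_region hL Λ')).frame hL
        (B6Elimination.blockClosed_region hL Λ')).IsTree ∧
      ((star L hL (B6Elimination.blockClosed_region hL Λ')).frame hL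
        (B6Elimination.blockClosed_region hL Λ')).IsTree :=
  ⟨BondModel.frame_isTree _ hL _, BondModel.frame_isTree _ hL _⟩

end Frame

end Literature.MathematicalPhysics.QuantumFieldTheory.Balaban1983to89.B9Eq3169Comb
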